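import Literature.IUT.HodgeTheaters.FKitCoreBridge
import Literature.IUT.HodgeTheaters.ThetaNFKit
import HarnessLib

/-!
# The ΘNF side of the §5/§6 kits FROM abc-iut-L5-t3's Definition 5.5 Hodge theaters: the global `φ^NF` dictionary
# `NFLink` and the construction `S5Local.ofDatum` (intra-layer merge C9-h, ΘNF side; defs + proofs)

S. Mochizuki, *Inter-universal Teichmüller theory I*, kurims manuscript (May 2020): Example 4.3 (ii), (iii) pp. 99–100
(the natural morphisms `†𝒟_v → †𝒟^⊚`), Definition 4.6 (iii) p. 112 (`𝒟`-ΘNF-Hodge theaters: "such that there exist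
isomorphisms `𝒟^⊚ ⥲ †𝒟^⊚`; `𝔇_⋆ ⥲ †𝔇_J`; `𝔇_> ⥲ †𝔇_>` conjugation by which maps `φ^NF_⋆ ↦ †φ^NF_⋆`, `φ^Θ_⋆ ↦ †φ^Θ_⋆`"),
Definition 5.5 (ii), (iii) pp. 152–153 (Θ-bridges "(a) `‡𝔉_J = {‡𝔉_j}_{j∈J}` … a capsule of `ℱ`-prime-strips …
(c) `‡𝔉_>` … the `ℱ`-prime-strip tautologically associated to `‡ℋ𝒯^Θ` … (d) … a `𝒟-Θ`-bridge `‡φ^Θ_⋇`";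
ΘNF-Hodge theaters `‡ℋ𝒯^{ΘNF} = (‡ℱ^⊛ ⇠ ‡ℱ^⊚ ← ‡𝔉_J → ‡𝔉_> ⇢ ‡ℋ𝒯^Θ)`), Remark 5.2.1 (i) p. 143
([IUTchI] Def 5.5 (iii) p.153) [claim: Mochizuki2012, status: disputed] (D-0012 claim key, series status DISPUTED —
this file is a DICTIONARY between two landed typings of the cell plus a construction; nothing of the series is
asserted and no side is taken on [IUTchIII] Cor. 3.12).

## Why this file exists (abc-iut-L5-t5's `ThetaNFKit.lean`: every field "TODO-merge:abc-iut-L5-t3")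

Layer L5's §6 files (Rmk 6.12.2, Def 6.13: `ThetaPMEllNFHodgeTheaters*`, `ThetaPMEllGluingRigidity*`) quantify over
abc-iut-L5-t5's HYPOTHESIS KIT `PMBaseKit.S5Local M FK` (`ThetaNFKit.lean`), whose fields STAND FOR abc-iut-L5-t3's
typing of [IUTchI] Def 5.5 (`ThetaNFHodgeTheaters.lean`: `S5Local.ThetaNFHodgeTheater S` with `J`, `capsuleF`, `HT`,
`underPolyΘ`, `psiNF`, …) — the kit's `ThetaNFHT` is an opaque TYPE.  With the `𝒟`-level dictionary `KitCore`
(`KitCoreBridge.lean`) and the ℱ-level dictionary `FKitCore` (`FKitCoreBridge.lean`) in the tree, the ΘNF side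
can now be READ OFF the real typing.  This file supplies:

* `KitCore.NFLink c` — the last dictionary field needed: abc-iut-L5-t3 types the morphisms `†𝒟_v → †𝒟^⊚` of Ex 4.3
  (ii), (iii) as an abstract type `𝔡.HomNF v X Y` with pre- and post-composition actions, abc-iut-L5-t4/t5 as morphisms
  `X ⟶ atV v Y` of the ambient category at `v` ("a global object seen at `v`", `S5Local.nfAtV`); the link is a
  functor `𝔡.AmbG ⥤ K.Amb x` and an INJECTION `HomNF ↪ (amb X ⟶ nfAtV Y)` compatible with both actions.  A
  HYPOTHESIS STRUCTURE (no field asserts a result of the series).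
* **`S5Local.ofDatum S fc nl : K.S5Local M FK`** — abc-iut-L5-t5's kit INSTANTIATED from abc-iut-L5-t3's data, by
  restriction along `e : K.V ↪ 𝕍` (no bijectivity needed): `CatAmb := 𝔡.AmbG`, `nfAtV := nl.nfAtV`,
  **`ThetaNFHT := S.ThetaNFHodgeTheater`** (the REAL Def 5.5 (iii) structure), `thJ H := H.J`, `thCapsule`/`thFgt` =
  the capsule `‡𝔉_J` and the tautological strip `‡𝔉_>` read in the kit through `famb`, `thDPoly` = `‡φ^Θ_⋇` read through
  `amb`/`baseComm`, and `IsDThetaNFHT B G nf :=` "`(B, G, nf)` is, through the dictionary, the image of an honest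
  §4 `𝒟`-ΘNF-Hodge theater `𝔡.DThetaNFHodgeTheater`" (Def 4.6 (iii), abc-iut-L5-t3's structure in the binder).
* Junction theorems (PROVED): `thetaBridgeData_ofDatum_poly` (the kit's underlying `𝒟-Θ`-bridge datum of `H` is the
  dictionary image of `H.under`'s), **`isDThetaNFHT_under`** — for every Def 5.5 (iii) Hodge theater `H`, its own
  associated data satisfy `IsDThetaNFHT` (witness `H.under`, Def 5.5 (iii): "the associated data `{‡φ^NF_⋆, ‡φ^Θ_⋆}`
  forms a `𝒟`-ΘNF-Hodge theater") — i.e. the first three fields of abc-iut-L5-t5's `IsoKit` are THEOREMS here.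

So every `N : K.S5Local M FK`-quantified §6 statement specialises, at `N := S5Local.ofDatum S fc nl`, to a statement
about Definition 5.5 Hodge theaters.  NOT here: the `IsoKit` instance (isomorphism notions, Cor 5.6 (ii) map) and a
KIT-RULE inhabitant of `NFLink` — companions.  typed ≠ proved elsewhere; here every `theorem` is kernel-checked.
-/

namespace Literature.IUT.HodgeTheaters

open CategoryTheory

universe v u

namespace BaseThetaDatum

section NFLink

variable {𝔡 : BaseThetaDatum.{v}} {K : PMBaseKit.{v} 𝔡.l}

/-! ### The global `φ^NF` dictionary -/

/-- **`NFLink(c)` — the dictionary for the morphisms `†𝒟_v → †𝒟^⊚`** over a `𝒟`-level core agreement `c : KitCore 𝔡 K`.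
[IUTchI] Example 4.3 (ii), (iii) pp. 99–100 attach to each `v` the natural morphism `φ^NF_{•,v} : 𝒟_v → 𝒟^⊚` and
consider poly-morphisms `†𝒟_v → †𝒟^⊚` abstractly equivalent to it; abc-iut-L5-t3 types these as an abstract type
`𝔡.HomNF v X Y` with pre-composition by isomorphisms of `†𝒟_v` and post-composition by isomorphisms of `†𝒟^⊚`
(`BaseThetaDatum.preNF` / `postNF`), abc-iut-L5-t5 as morphisms `X ⟶ nfAtV v Y` of the kit's ambient category at `v`
towards "a global object seen at `v`" (`S5Local.nfAtV`, the `atV` pattern of Def 6.1 (v)).  Rendered: a functor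
`𝔡.AmbG ⥤ K.Amb x` at each kit place and an injection of abc-iut-L5-t3's `φ^NF`-type morphisms into the kit's
morphisms, compatible with both actions.  A HYPOTHESIS STRUCTURE (no field asserts a result of the series).
([IUTchI] Ex 4.3 (ii) p.99) [claim: Mochizuki2012, status: disputed] -/
structure KitCore.NFLink (c : 𝔡.KitCore K) where
  /-- Ex 4.3 (ii)/(iii): an isomorph `†𝒟^⊚` of `𝒟^⊚` "seen at `v`" — an object of the kit's ambient category at `x`,
  functorially in `†𝒟^⊚` (abc-iut-L5-t5's `nfAtV`) -/
  nfAtV : ∀ x : K.V, 𝔡.AmbG ⥤ K.Amb x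
  /-- the `φ^NF`-type morphisms `†𝒟_v → †𝒟^⊚` of abc-iut-L5-t3 (`HomNF`) ARE morphisms `†𝒟_v ⟶ nfAtV v †𝒟^⊚` of the kit … -/
  homNF : ∀ (x : K.V) (X : 𝔡.Amb (c.e x)) (Y : 𝔡.AmbG), 𝔡.HomNF (c.e x) X Y → ((c.amb x).obj X ⟶ (nfAtV x).obj Y)
  /-- … faithfully (distinct `φ^NF`-type morphisms are distinct morphisms) … -/
  homNF_injective : ∀ (x : K.V) (X : 𝔡.Amb (c.e x)) (Y : 𝔡.AmbG), Function.Injective (homNF x X Y)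
  /-- … compatibly with "pre-composition with a morphism" of `†𝒟_v` (Def 4.1 (v)) … -/
  homNF_preNF : ∀ (x : K.V) {X X' : 𝔡.Amb (c.e x)} {Y : 𝔡.AmbG} (a : X' ≅ X) (f : 𝔡.HomNF (c.e x) X Y),
    homNF x X' Y (𝔡.preNF a f) = (c.amb x).map a.hom ≫ homNF x X Y f
  /-- … and with "post-composition with an isomorphism `†𝒟^⊚ ⥲ ‡𝒟^⊚`" (Def 4.1 (v)). -/
  homNF_postNF : ∀ (x : K.V) {X : 𝔡.Amb (c.e x)} {Y Y' : 𝔡.AmbG} (f : 𝔡.HomNF (c.e x) X Y) (b : Y ≅ Y'),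
    homNF x X Y' (𝔡.postNF f b) = homNF x X Y f ≫ (nfAtV x).map b.hom

end NFLink

namespace S5Local

/-! Universe note: abc-iut-L5-t3's `ThetaNFHodgeTheater S` carries its index TYPE `J : Type` as a field, so it lives
in `Type (max 1 u)`; abc-iut-L5-t5's slot `ThetaNFHT : Type u` is therefore instantiated for kits in a successor
universe `u+1` (every §6 statement is universe-polymorphic in the kit, so nothing is lost). -/

variable {𝔡 : BaseThetaDatum.{u+1}} {K : PMBaseKit.{u+1} 𝔡.l} (S : S5Local 𝔡) {c : 𝔡.KitCore K} {M : K.MultKit}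
  {FK : K.FKit M}

/-! ### Reading abc-iut-L5-t3's ℱ-prime-strips and poly-morphisms in the kit -/

/-- An `ℱ`-prime-strip of abc-iut-L5-t3 (a family of isomorphs of the `ℱ_v`, Def 5.2 (i)) read in the kit through
the ℱ-level dictionary, by restriction along `e : K.V ↪ 𝕍`: an `FStrip` of abc-iut-L5-t4.
([IUTchI] Def 5.2 (i) p.134) [claim: Mochizuki2012, status: disputed] -/
noncomputable def FKitCore.fStrip (fc : S.FKitCore c FK) (X : S.FPrimeStrip) : FK.FStrip where
  obj x := (fc.famb x).obj (X (c.e x))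
  isModel x := ⟨fc.isoModel x (X (c.e x))⟩

/-- A poly-morphism between constituents of the associated `𝒟`-prime-strips of two `ℱ`-prime-strips of abc-iut-L5-t3
(morphisms `base(X_v) → base(Y_v)` in `𝔡.Amb v`), read in the kit between the associated `𝒟`-prime-strips of their
images (Rmk 5.2.1 (i) on both sides, through `amb` and `baseComm`).
([IUTchI] Rmk 5.2.1 (i) p.143) [claim: Mochizuki2012, status: disputed] -/
def FKitCore.dPoly (fc : S.FKitCore c FK) {X Y : S.FPrimeStrip} (x : K.V)
    (P : PolyHom (X.base (c.e x)) (Y.base (c.e x))) :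
    Set ((fc.fStrip S X).assocD.obj x ⟶ (fc.fStrip S Y).assocD.obj x) :=
  {g | ∃ f ∈ P, g = ((fc.baseComm x).app (X (c.e x))).inv ≫ (c.amb x).map f ≫ ((fc.baseComm x).app (Y (c.e x))).hom}

/-! ### The construction -/

variable {S}

/-- **`S5Local.ofDatum` — abc-iut-L5-t5's ΘNF-side kit INSTANTIATED from abc-iut-L5-t3's Definition 5.5 typing**, by
restriction along the dictionaries `KitCore` / `FKitCore` / `NFLink`: global base objects := the isomorphs of `𝒟^⊚`
(`𝔡.AmbG`) seen at `v` through `nfAtV`; **ΘNF-Hodge theaters := `S.ThetaNFHodgeTheater`** (Def 5.5 (iii)); for such an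
`‡ℋ𝒯^{ΘNF} = H`: index set `J := H.J`, capsule `‡𝔉_J := H.capsuleF` and `‡𝔉_> :=` the strip tautologically associated to
`H.HT` (Def 5.5 (ii) (a), (c)), both read in the kit, `𝒟-Θ`-bridge constituents `‡φ^Θ_{v_j} := H.underPolyΘ` read in the
kit (Def 5.5 (ii) (d)); and the predicate "forms a `𝒟`-ΘNF-Hodge theater" (Def 4.6 (iii)) := "is, through the
dictionary, the image of an honest `𝔡.DThetaNFHodgeTheater`" (bijection of index sets, isomorphisms of the
constituents and of the global object, conjugation carrying `φ^Θ_⋆`, `φ^NF_⋆` EXACTLY).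
([IUTchI] Def 5.5 (iii) p.153) [claim: Mochizuki2012, status: disputed] -/
noncomputable def ofDatum (fc : S.FKitCore c FK) (nl : c.NFLink) : K.S5Local M FK where
  CatAmb := 𝔡.AmbG
  nfAtV := nl.nfAtV
  IsDThetaNFHT B G nf :=
    ∃ (H : 𝔡.DThetaNFHodgeTheater) (ι : B.J ≃ H.J)
      (κ : ∀ j x, (c.amb x).obj (H.capsule (ι j) (c.e x)) ≅ (B.capsule j).obj x)
      (γ : ∀ x, (c.amb x).obj (H.cod (c.e x)) ≅ B.codomain.obj x) (δ : H.glob ≅ G),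
      (∀ j x, B.poly j x =
          {g | ∃ f ∈ H.polyΘ (ι j) (c.e x), g = (κ j x).inv ≫ (c.amb x).map f ≫ (γ x).hom}) ∧
        ∀ j x, nf j x =
          {g | ∃ f ∈ H.polyNF (ι j) (c.e x), g = (κ j x).inv ≫ nl.homNF x _ _ (𝔡.postNF f δ)}
  ThetaNFHT := S.ThetaNFHodgeTheater
  thJ H := H.J
  thCapsule H j := fc.fStrip S (H.capsuleF j)
  thFgt H := fc.fStrip S (S.assocStrip H.HT)
  thDPoly H j x := fc.dPoly S x (H.underPolyΘ j (c.e x))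

variable (fc : S.FKitCore c FK) (nl : c.NFLink)

/-- The type of ΘNF-Hodge theaters of the instantiated kit IS abc-iut-L5-t3's Def 5.5 (iii) structure.
([IUTchI] Def 5.5 (iii) p.153) [claim: Mochizuki2012, status: disputed] -/
theorem ofDatum_thetaNFHT : (ofDatum fc nl).ThetaNFHT = S.ThetaNFHodgeTheater := rfl

/-- The underlying `𝒟-Θ`-bridge datum that abc-iut-L5-t5 attaches to a ΘNF-Hodge theater (`S5Local.thetaBridgeData`,
Def 5.5 (ii): "any Θ-bridge … determines an associated `𝒟-Θ`-bridge"), computed for the instantiated kit: its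
constituent at `(j, x)` is `H`'s `‡φ^Θ_{v_j}` (abc-iut-L5-t3's `underPolyΘ`, i.e. the poly-morphism of `H.under`) read in
the kit. ([IUTchI] Def 5.5 (ii) p.153) [claim: Mochizuki2012, status: disputed] -/
theorem thetaBridgeData_ofDatum_poly (H : S.ThetaNFHodgeTheater) (j : ULift H.J) (x : K.V) :
    ((ofDatum fc nl).thetaBridgeData H).poly j x = fc.dPoly S x (H.underPolyΘ j.down (c.e x)) := rfl

/-- **Def 5.5 (iii) for the instantiated kit: "the associated data `{‡φ^NF_⋆, ‡φ^Θ_⋆}` forms a `𝒟`-ΘNF-Hodge theater"** —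
the kit predicate `IsDThetaNFHT` HOLDS for the underlying `𝒟-Θ`-bridge datum of every Def 5.5 (iii) Hodge theater
`H`, its global base object `‡𝒟^⊚ = base(‡ℱ^⊚)` and its `𝒟`-NF-bridge poly-morphisms (the intrinsic `under` of
`‡ψ^NF_⋆`, Ex 5.4 (iii)) read in the kit — witnessed by abc-iut-L5-t3's `H.under : 𝔡.DThetaNFHodgeTheater` with identity
identifications.  (This discharges the fields `thGlob` / `thNFPoly` / `th_isHT` of abc-iut-L5-t5's `IsoKit` as
THEOREMS for `ofDatum`.) ([IUTchI] Def 5.5 (iii) p.153) [claim: Mochizuki2012, status: disputed] -/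
theorem isDThetaNFHT_under (H : S.ThetaNFHodgeTheater) :
    (ofDatum fc nl).IsDThetaNFHT ((ofDatum fc nl).thetaBridgeData H) (S.baseG H.globF)
      (fun j x => {g | ∃ f ∈ (H.psiNF j.down).under (c.e x),
        g = ((fc.baseComm x).app (H.capsuleF j.down (c.e x))).inv ≫ nl.homNF x _ _ f}) := by
  refine ⟨H.under, Equiv.ulift, fun j x => (fc.baseComm x).app (H.capsuleF j.down (c.e x)),
    fun x => (fc.baseComm x).app (S.assocStrip H.HT (c.e x)), Iso.refl _, fun j x => rfl, fun j x => ?_⟩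
  ext g
  constructor
  · rintro ⟨f, hf, rfl⟩
    exact ⟨f, hf, (congrArg (fun g => ((fc.baseComm x).app (H.capsuleF j.down (c.e x))).inv ≫ nl.homNF x _ _ g)
      (𝔡.postNF_refl f)).symm⟩
  · rintro ⟨f, hf, rfl⟩
    exact ⟨f, hf, congrArg (fun g => ((fc.baseComm x).app (H.capsuleF j.down (c.e x))).inv ≫ nl.homNF x _ _ g)
      (𝔡.postNF_refl f)⟩

/-- **Every `N`-quantified §6 statement is now a statement about Def 5.5 Hodge theaters**: e.g. abc-iut-L5-t5's
`DNFHT` (a `𝒟`-ΘNF-Hodge theater in kit form) is inhabited, for the instantiated kit, by the associated data of any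
ΘNF-Hodge theater of abc-iut-L5-t3 (the object [IUTchI] Def 6.13 (ii) glues).
([IUTchI] Def 5.5 (iii) p.153) [claim: Mochizuki2012, status: disputed] -/
noncomputable def dnfhtOf (H : S.ThetaNFHodgeTheater) : (ofDatum fc nl).DNFHT :=
  ⟨(ofDatum fc nl).thetaBridgeData H, S.baseG H.globF, _, isDThetaNFHT_under fc nl H⟩

end S5Local

end BaseThetaDatum

end Literature.IUT.HodgeTheaters
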